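import Literature.Analysis.FluidPDE.SeisDissipationRateBoundProofs
import Literature.Analysis.FunctionSpaces.TorusMollifiedGradNorm
import Literature.Analysis.FunctionSpaces.TorusTimeAverage
import Literature.Analysis.FunctionSpaces.TorusSpectralWeakDerivative
import HarnessLib

/-!
# Minkowski's inequality for the spectral gradient norm of a time average

Analysis/FluidPDE proof-support file (everything proved). For a space–time field
`U ∈ L¹(ℝ × T^d; ℝ^d)` and a continuous compactly supported weight `r ≥ 0`, the time average
`w(t) = ∫ r(t-s) U(s) ds` (`FunctionSpaces.timeAvgWith r U t`) satisfies the Minkowski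
inequality for the `Ḣ¹` seminorm

  `eGradNormSq (w t) ^ (1/2) ≤ ∫⁻ s, ofReal (r (t - s)) * eGradNormSq (U s) ^ (1/2)`
  (`eGradNormSq_rpow_half_timeAvgWith_le`),

and, integrated in time with `∫ r = 1`, `∫⁻ t, eGradNormSq (w t)^(1/2) ≤ ∫⁻ s, eGradNormSq (U s)^(1/2)`
(`lintegral_eGradNormSq_rpow_half_timeAvgWith_le`). Proof on the Fourier side: the coefficients
of `w(t)` are the time averages of those of `U(s)` (Fubini), and for every finite set of
frequencies the weighted coefficient vector is a Bochner integral in a finite-dimensional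
Euclidean space, whose norm is at most the integral of the norms; the supremum over finite sets
is `eGradNormSq`. This is the strain control `∫₀ᵀ ‖∇uₙ‖_{L²} ≤ ∫₀ᵀ ‖∇u‖_{L²}` of mollified drifts
(DiPerna–Lions 1989, §II.3: regularised coefficients keep their `W^{1,q}` budget).

## References

* R. J. DiPerna, P.-L. Lions, Invent. Math. 98 (1989), §II.3. [`DiPernaLions1989`]
* L. Grafakos, *Classical Fourier Analysis*, 3rd ed. (2014), Prop. 3.2.7. [`Grafakos2014`]
-/

noncomputable section

open MeasureTheory Set Function Filter Topology UnitAddTorus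
open scoped ENNReal NNReal InnerProductSpace
open Literature.Analysis.FunctionSpaces Literature.Analysis.FunctionSpaces.Torus

namespace Literature.Analysis.FluidPDE

namespace Torus

variable {d : Type*} [Fintype d]

section Minkowski

variable {U : ℝ → UnitAddTorus d → EuclideanSpace ℝ d} {r : ℝ → ℝ}

/-- `‖𝓕 g (k)‖ ≤ ∫ ‖g‖` on `T^d`. [folklore] -/
theorem norm_mFourierCoeff_le_integral_norm_of_integrable {F : Type*} [NormedAddCommGroup F] [NormedSpace ℂ F] [CompleteSpace F]
    {g : UnitAddTorus d → F} (hg : Integrable g volume) (k : d → ℤ) : ‖mFourierCoeff g k‖ ≤ ∫ x, ‖g x‖ := by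
  rw [mFourierCoeff_eq_integral_volume]
  refine (norm_integral_le_integral_norm _).trans (integral_mono_of_nonneg (Eventually.of_forall fun x => norm_nonneg _)
    hg.norm (Eventually.of_forall fun x => ?_))
  show ‖(mFourier (-k) x : ℂ) • g x‖ ≤ ‖g x‖
  rw [norm_smul]
  exact mul_le_of_le_one_left (norm_nonneg _) (((mFourier (-k)).norm_coe_le_norm x).trans_eq mFourier_norm)

/-- Measurability of `s ↦ 𝓕(complexify ∘ U s)(k)` for a jointly measurable field. [folklore] -/
theorem aestronglyMeasurable_coeff_complexify_slice {μ : Measure ℝ} [SFinite μ]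
    (hU : AEStronglyMeasurable (uncurry U) (μ.prod volume)) (k : d → ℤ) :
    AEStronglyMeasurable (fun s => mFourierCoeff (EuclideanSpace.complexify ∘ U s) k) μ := by
  have hF : AEStronglyMeasurable (fun z : ℝ × UnitAddTorus d =>
      (mFourier (-k) z.2 : ℂ) • EuclideanSpace.complexify (U z.1 z.2)) (μ.prod volume) :=
    ((mFourier (-k)).continuous.aestronglyMeasurable.comp_snd).smul
      (EuclideanSpace.complexify.continuous.comp_aestronglyMeasurable hU)
  have e : (fun s => mFourierCoeff (EuclideanSpace.complexify ∘ U s) k) =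
      fun s => ∫ y, (mFourier (-k) y : ℂ) • (EuclideanSpace.complexify ∘ U s) y :=
    funext fun s => mFourierCoeff_eq_integral_volume _ _
  rw [e]
  exact hF.integral_prod_right'

/-- **Fourier coefficients of a time average are time averages of Fourier coefficients**:
`𝓕(complexify ∘ timeAvgWith r U t)(k) = ∫ r(t-s) • 𝓕(complexify ∘ U s)(k) ds` for
`U ∈ L¹(ℝ × T^d)` and continuous compactly supported `r` (Fubini). [folklore] -/
theorem mFourierCoeff_complexify_timeAvgWith (hUi : Integrable (uncurry U) ((volume : Measure ℝ).prod volume))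
    (hr : Continuous r) (hrs : HasCompactSupport r) (t : ℝ) (k : d → ℤ) :
    mFourierCoeff (EuclideanSpace.complexify ∘ timeAvgWith r U t) k =
      ∫ s, (r (t - s) : ℂ) • mFourierCoeff (EuclideanSpace.complexify ∘ U s) k := by
  obtain ⟨Cr, hCr0, hCr⟩ := exists_forall_abs_le_of_hasCompactSupport' hr hrs
  have hrc : Continuous fun s => r (t - s) := hr.comp (continuous_const.sub continuous_id)
  set cx := (EuclideanSpace.complexify (ι := d)) with hcx
  -- the integrand on `T^d × ℝ`
  set F : UnitAddTorus d → ℝ → EuclideanSpace ℂ d := fun y s => (mFourier (-k) y : ℂ) • ((r (t - s) : ℂ) • cx (U s y)) with hF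
  have hFi : Integrable (uncurry F) ((volume : Measure (UnitAddTorus d)).prod volume) := by
    have hsw : Integrable (fun q : UnitAddTorus d × ℝ => U q.2 q.1) ((volume : Measure (UnitAddTorus d)).prod volume) :=
      hUi.swap
    have hm : AEStronglyMeasurable (uncurry F) ((volume : Measure (UnitAddTorus d)).prod volume) := by
      refine ((mFourier (-k)).continuous.aestronglyMeasurable.comp_fst).smul ?_
      refine ((Complex.continuous_ofReal.comp (hrc.comp continuous_snd)).aestronglyMeasurable).smul ?_
      exact cx.continuous.comp_aestronglyMeasurable hsw.1
    refine Integrable.mono' (hsw.norm.const_mul Cr) hm (Eventually.of_forall fun q => ?_)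
    simp only [hF, uncurry, norm_smul, Complex.norm_real, Real.norm_eq_abs]
    rw [LinearIsometry.norm_map]
    calc ‖(mFourier (-k) q.1 : ℂ)‖ * (|r (t - q.2)| * ‖U q.2 q.1‖) ≤ 1 * (Cr * ‖U q.2 q.1‖) :=
          mul_le_mul (((mFourier (-k)).norm_coe_le_norm q.1).trans_eq mFourier_norm)
            (mul_le_mul_of_nonneg_right (hCr _) (norm_nonneg _)) (by positivity) zero_le_one
      _ = Cr * ‖U q.2 q.1‖ := one_mul _
  -- left side: `∫_y e_{-k}(y) • cx (∫ r(t-s) • U s y ds) = ∫_y ∫_s F y s`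
  have hy : ∀ᵐ y ∂(volume : Measure (UnitAddTorus d)), Integrable (fun s => U s y) volume := hUi.prod_left_ae
  have hL : mFourierCoeff (cx ∘ timeAvgWith r U t) k = ∫ y, ∫ s, F y s := by
    rw [mFourierCoeff_eq_integral_volume]
    refine integral_congr_ae ?_
    filter_upwards [hy] with y hy
    have hiy : Integrable (fun s => r (t - s) • U s y) volume := by
      refine Integrable.mono' (hy.norm.const_mul Cr) (hrc.aestronglyMeasurable.smul hy.1) (Eventually.of_forall fun s => ?_)
      rw [norm_smul, Real.norm_eq_abs]
      exact mul_le_mul_of_nonneg_right (hCr _) (norm_nonneg _)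
    show (mFourier (-k) y : ℂ) • cx (timeAvgWith r U t y) = ∫ s, F y s
    have e1 : cx (∫ s, r (t - s) • U s y) = ∫ s, cx (r (t - s) • U s y) := by
      have := (cx.toContinuousLinearMap.integral_comp_comm hiy).symm
      simpa only [LinearIsometry.coe_toContinuousLinearMap] using this
    rw [timeAvgWith_eq_integral_sub, e1, ← integral_smul]
    refine integral_congr_ae (Eventually.of_forall fun s => ?_)
    simp only [hF, LinearIsometry.map_smul, Complex.coe_smul]
  rw [hL, integral_integral_swap hFi]
  refine integral_congr_ae (Eventually.of_forall fun s => ?_)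
  show ∫ y, F y s = (r (t - s) : ℂ) • mFourierCoeff (cx ∘ U s) k
  rw [mFourierCoeff_eq_integral_volume, ← integral_smul]
  refine integral_congr_ae (Eventually.of_forall fun y => ?_)
  simp only [hF, comp_apply]
  rw [smul_comm]

omit [Fintype d] in
/-- The `ℝ≥0∞` form of the `PiLp 2` norm: `‖x‖ₑ² = ∑ᵢ ‖xᵢ‖ₑ²`. [folklore] -/
theorem enorm_sq_piLp_two {ι : Type*} [Fintype ι] {β : ι → Type*} [∀ i, SeminormedAddCommGroup (β i)]
    (x : PiLp 2 β) : ‖x‖ₑ ^ 2 = ∑ i, ‖x.ofLp i‖ₑ ^ 2 := by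
  rw [← ofReal_norm, ← ENNReal.ofReal_pow (norm_nonneg _), PiLp.norm_sq_eq_of_L2,
    ENNReal.ofReal_sum_of_nonneg fun i _ => sq_nonneg _]
  refine Finset.sum_congr rfl fun i _ => ?_
  rw [← ofReal_norm, ENNReal.ofReal_pow (norm_nonneg _)]

/-- **Minkowski's inequality for the `Ḣ¹` seminorm of a time average**, squared form:
`eGradNormSq (timeAvgWith r U t) ≤ (∫⁻ r(t-s) ‖∇U(s)‖₂ ds)²` for `r ≥ 0` continuous with
compact support and `U ∈ L¹(ℝ × T^d)`. [cite: DiPernaLions1989, §II.3] -/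
theorem eGradNormSq_timeAvgWith_le_sq (hUi : Integrable (uncurry U) ((volume : Measure ℝ).prod volume))
    (hr : Continuous r) (hrs : HasCompactSupport r) (hr0 : ∀ s, 0 ≤ r s) (t : ℝ) :
    eGradNormSq (timeAvgWith r U t) ≤
      (∫⁻ s, ENNReal.ofReal (r (t - s)) * eGradNormSq (U s) ^ (1 / 2 : ℝ)) ^ 2 := by
  classical
  obtain ⟨Cr, hCr0, hCr⟩ := exists_forall_abs_le_of_hasCompactSupport' hr hrs
  have hrc : Continuous fun s => r (t - s) := hr.comp (continuous_const.sub continuous_id)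
  set cx := (EuclideanSpace.complexify (ι := d)) with hcx
  set R : ℝ≥0∞ := ∫⁻ s, ENNReal.ofReal (r (t - s)) * eGradNormSq (U s) ^ (1 / 2 : ℝ) with hR
  set c : (d → ℤ) → ℝ := fun k => 2 * Real.pi * Real.sqrt (freqNormSq k) with hc
  have hc0 : ∀ k, 0 ≤ c k := fun k => by rw [hc]; positivity
  have hc2 : ∀ k, ENNReal.ofReal (c k) ^ 2 = ENNReal.ofReal (4 * Real.pi ^ 2) * ENNReal.ofReal (freqNormSq k) := fun k => by
    rw [← ENNReal.ofReal_pow (hc0 k), ← ENNReal.ofReal_mul (by positivity), hc]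
    congr 1
    rw [mul_pow, mul_pow, Real.sq_sqrt (freqNormSq_nonneg k)]; ring
  -- the weighted finite sums
  have hfin : ∀ (w : UnitAddTorus d → EuclideanSpace ℝ d) (K : Finset (d → ℤ)),
      ENNReal.ofReal (4 * Real.pi ^ 2) * ∑ k ∈ K, ENNReal.ofReal (freqNormSq k) * ‖mFourierCoeff (cx ∘ w) k‖ₑ ^ 2 =
        ∑ k ∈ K, (ENNReal.ofReal (c k) * ‖mFourierCoeff (cx ∘ w) k‖ₑ) ^ 2 := fun w K => by
    rw [Finset.mul_sum]
    refine Finset.sum_congr rfl fun k _ => ?_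
    rw [mul_pow, hc2, mul_assoc]
  have hfin_le : ∀ (w : UnitAddTorus d → EuclideanSpace ℝ d) (K : Finset (d → ℤ)),
      ∑ k ∈ K, (ENNReal.ofReal (c k) * ‖mFourierCoeff (cx ∘ w) k‖ₑ) ^ 2 ≤ eGradNormSq w := fun w K => by
    rw [← hfin, eGradNormSq_eq_tsum]
    exact mul_le_mul_right (ENNReal.sum_le_tsum K) _
  rw [eGradNormSq_eq_tsum, ENNReal.tsum_eq_iSup_sum, ENNReal.mul_iSup]
  refine iSup_le fun K => ?_
  rw [hfin]
  -- the finite-dimensional Bochner integral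
  set V : ℝ → PiLp 2 (fun _ : ↥K => EuclideanSpace ℂ d) := fun s =>
    WithLp.toLp 2 fun k => ((r (t - s) * c k : ℝ) : ℂ) • mFourierCoeff (cx ∘ U s) k with hV
  -- (1) pointwise norm bound
  have hVn : ∀ s, ‖V s‖ₑ ≤ ENNReal.ofReal (r (t - s)) * eGradNormSq (U s) ^ (1 / 2 : ℝ) := by
    intro s
    refine (ENNReal.pow_le_pow_left_iff two_ne_zero).1 ?_
    rw [enorm_sq_piLp_two, mul_pow, ← ENNReal.rpow_two (eGradNormSq (U s) ^ (1 / 2 : ℝ)), ← ENNReal.rpow_mul]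
    norm_num
    calc ∑ k : ↥K, ‖(V s).ofLp k‖ₑ ^ 2
        = ∑ k : ↥K, ENNReal.ofReal (r (t - s)) ^ 2 * (ENNReal.ofReal (c k) * ‖mFourierCoeff (cx ∘ U s) k‖ₑ) ^ 2 := by
          refine Finset.sum_congr rfl fun k _ => ?_
          simp only [hV, enorm_smul]
          rw [← ofReal_norm (((r (t - s) * c k : ℝ) : ℂ)), Complex.norm_real, Real.norm_eq_abs,
            abs_of_nonneg (mul_nonneg (hr0 _) (hc0 _)), ENNReal.ofReal_mul (hr0 _)]
          ring
      _ = ENNReal.ofReal (r (t - s)) ^ 2 * ∑ k ∈ K, (ENNReal.ofReal (c k) * ‖mFourierCoeff (cx ∘ U s) k‖ₑ) ^ 2 := by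
          rw [Finset.mul_sum, Finset.sum_coe_sort K fun k => ENNReal.ofReal (r (t - s)) ^ 2 *
            (ENNReal.ofReal (c k) * ‖mFourierCoeff (cx ∘ U s) k‖ₑ) ^ 2]
      _ ≤ ENNReal.ofReal (r (t - s)) ^ 2 * eGradNormSq (U s) := mul_le_mul_right (hfin_le _ K) _
  -- (2) componentwise integrability
  have hsl : ∀ᵐ s ∂(volume : Measure ℝ), Integrable (U s) volume := hUi.prod_right_ae
  have hN : Integrable (fun s => ∫ y, ‖uncurry U (s, y)‖) volume := hUi.integral_norm_prod_left
  have hVi : ∀ k : ↥K, Integrable (fun s => (V s).ofLp k) volume := by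
    intro k
    have hm : AEStronglyMeasurable (fun s => (V s).ofLp k) volume := by
      simp only [hV]
      exact ((Complex.continuous_ofReal.comp (hrc.mul continuous_const)).aestronglyMeasurable).smul
        (aestronglyMeasurable_coeff_complexify_slice hUi.1 k)
    refine Integrable.mono' (hN.const_mul (Cr * c k)) hm ?_
    filter_upwards [hsl] with s hs
    simp only [hV, norm_smul, Complex.norm_real, Real.norm_eq_abs]
    have h1 : ‖mFourierCoeff (cx ∘ U s) k‖ ≤ ∫ y, ‖uncurry U (s, y)‖ := by
      refine (norm_mFourierCoeff_le_integral_norm_of_integrable (cx.toContinuousLinearMap.integrable_comp hs) k).trans (le_of_eq ?_)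
      refine integral_congr_ae (Eventually.of_forall fun y => ?_)
      show ‖cx.toContinuousLinearMap (U s y)‖ = ‖U s y‖
      rw [LinearIsometry.coe_toContinuousLinearMap, LinearIsometry.norm_map]
    have h2 : |r (t - s) * c k| ≤ Cr * c k := by
      rw [abs_mul, abs_of_nonneg (hc0 _)]
      exact mul_le_mul_of_nonneg_right (hCr _) (hc0 _)
    exact mul_le_mul h2 h1 (norm_nonneg _) (by positivity)
  -- (3) the components of `∫ V`
  have hcomp : ∀ k : ↥K, (∫ s, V s).ofLp k = (c k : ℂ) • mFourierCoeff (cx ∘ timeAvgWith r U t) k := by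
    intro k
    rw [eval_integral_piLp hVi k, mFourierCoeff_complexify_timeAvgWith hUi hr hrs t k, ← integral_smul]
    refine integral_congr_ae (Eventually.of_forall fun s => ?_)
    simp only [hV, Complex.ofReal_mul, mul_smul]
    rw [smul_comm]
  -- (4) Minkowski in the finite-dimensional space
  have hM : ‖∫ s, V s‖ₑ ≤ R :=
    (enorm_integral_le_lintegral_enorm _).trans (lintegral_mono fun s => hVn s)
  calc ∑ k ∈ K, (ENNReal.ofReal (c k) * ‖mFourierCoeff (cx ∘ timeAvgWith r U t) k‖ₑ) ^ 2
      = ∑ k : ↥K, ‖(∫ s, V s).ofLp k‖ₑ ^ 2 := by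
        rw [← Finset.sum_coe_sort K]
        refine Finset.sum_congr rfl fun k _ => ?_
        rw [hcomp k, enorm_smul, ← ofReal_norm ((c k : ℝ) : ℂ), Complex.norm_real, Real.norm_eq_abs, abs_of_nonneg (hc0 _)]
    _ = ‖∫ s, V s‖ₑ ^ 2 := (enorm_sq_piLp_two _).symm
    _ ≤ R ^ 2 := by gcongr

/-- **Minkowski's inequality for the `Ḣ¹` seminorm of a time average**:
`‖∇(timeAvgWith r U t)‖₂ ≤ ∫⁻ r(t-s) ‖∇U(s)‖₂ ds` (spectral form). [cite: DiPernaLions1989, §II.3] -/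
theorem eGradNormSq_rpow_half_timeAvgWith_le (hUi : Integrable (uncurry U) ((volume : Measure ℝ).prod volume))
    (hr : Continuous r) (hrs : HasCompactSupport r) (hr0 : ∀ s, 0 ≤ r s) (t : ℝ) :
    eGradNormSq (timeAvgWith r U t) ^ (1 / 2 : ℝ) ≤
      ∫⁻ s, ENNReal.ofReal (r (t - s)) * eGradNormSq (U s) ^ (1 / 2 : ℝ) := by
  have h := ENNReal.rpow_le_rpow (eGradNormSq_timeAvgWith_le_sq hUi hr hrs hr0 t) (by norm_num : (0 : ℝ) ≤ 1 / 2)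
  rwa [← ENNReal.rpow_two, ← ENNReal.rpow_mul, show (2 : ℝ) * (1 / 2) = 1 by norm_num, ENNReal.rpow_one] at h

/-- **Time integration**: with `∫ r = 1`,
`∫⁻ t, ‖∇(timeAvgWith r U t)‖₂ dt ≤ ∫⁻ s, ‖∇U(s)‖₂ ds`. [cite: DiPernaLions1989, §II.3] -/
theorem lintegral_eGradNormSq_rpow_half_timeAvgWith_le (hUm : AEStronglyMeasurable (uncurry U) ((volume : Measure ℝ).prod volume))
    (hUi : Integrable (uncurry U) ((volume : Measure ℝ).prod volume))
    (hr : Continuous r) (hrs : HasCompactSupport r) (hr0 : ∀ s, 0 ≤ r s) (hr1 : ∫ s, r s = 1) :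
    ∫⁻ t, eGradNormSq (timeAvgWith r U t) ^ (1 / 2 : ℝ) ≤ ∫⁻ s, eGradNormSq (U s) ^ (1 / 2 : ℝ) := by
  set g : ℝ → ℝ≥0∞ := fun s => eGradNormSq (U s) ^ (1 / 2 : ℝ) with hg
  have hgm : AEMeasurable g volume := (aemeasurable_eGradNormSq_slice hUm).pow_const _
  have hFm : AEMeasurable (uncurry fun t s => ENNReal.ofReal (r (t - s)) * g s) ((volume : Measure ℝ).prod volume) := by
    refine (((hr.comp (continuous_fst.sub continuous_snd)).measurable.ennreal_ofReal).aemeasurable).mul ?_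
    exact hgm.comp_quasiMeasurePreserving Measure.quasiMeasurePreserving_snd
  calc ∫⁻ t, eGradNormSq (timeAvgWith r U t) ^ (1 / 2 : ℝ)
      ≤ ∫⁻ t, ∫⁻ s, ENNReal.ofReal (r (t - s)) * g s := lintegral_mono fun t => eGradNormSq_rpow_half_timeAvgWith_le hUi hr hrs hr0 t
    _ = ∫⁻ s, ∫⁻ t, ENNReal.ofReal (r (t - s)) * g s := lintegral_lintegral_swap hFm
    _ = ∫⁻ s, (∫⁻ t, ENNReal.ofReal (r (t - s))) * g s := by
        refine lintegral_congr fun s => ?_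
        have hm : AEMeasurable (fun t => ENNReal.ofReal (r (t - s))) volume :=
          (hr.comp (continuous_id.sub continuous_const)).measurable.ennreal_ofReal.aemeasurable
        rw [lintegral_mul_const'' _ hm]
    _ = ∫⁻ s, g s := by
        refine lintegral_congr fun s => ?_
        have e : ∫⁻ t, ENNReal.ofReal (r (t - s)) = 1 := by
          rw [lintegral_sub_right_eq_self (fun t => ENNReal.ofReal (r t)) s,
            ← ofReal_integral_eq_lintegral_ofReal (hr.integrable_of_hasCompactSupport hrs) (Eventually.of_forall hr0),
            hr1, ENNReal.ofReal_one]
        rw [e, one_mul]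

end Minkowski

end Torus

end Literature.Analysis.FluidPDE
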